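import Literature.AlgebraicGeometry.ComplexMultiplication.CyclotomicFermatCMTypesPrimePowerLevelSimple
import HarnessLib

/-!
# Koblitz–Rohrlich, THEOREM 3 / the §4 PROPOSITION IN FULL at `N = 27` (`n = 3`): every non-obvious coincidence `H_τ = H_{τ′}` modulo `27`
# is, up to a common unit, the pair `(1, 7, 19)`, `(3, 7, 17)`

Layer `Literature/AlgebraicGeometry/ComplexMultiplication`, namespace `…ComplexMultiplication.CyclotomicFermatCMType`; companion of
`CyclotomicFermatCMTypesThreePowerLevelIsogenies` (the Proposition in full at `N = 9`; the listed pairs at `27`, `81`; not imported —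
only `CyclotomicFermatCMTypesPrimePowerLevelSimple`'s scaling lemma `mem_fermatCMType_mul_iff_of_isUnit` is used).  THEOREMS ONLY (no
definition, no named fact, no `sorry`): one kernel enumeration (`decide`, normalised: first triple through `1`, `27³` cases) and the
normalisation glue of K–R §1/§4 ("multiply through by a suitable `u ∈ (ℤ/Nℤ)*`"), written for any level and any exceptional pair `(A, B)`.

THE SOURCE.  N. Koblitz, D. Rohrlich, *Simple factors in the Jacobian of a Fermat curve*, Canad. J. Math. **30** (1978) 1183–1205, §4
(p. 1198): "PROPOSITION. Let `N = 3ⁿ`, `N₁ = 3ⁿ⁻¹`, `τ = (r, s, t)`, `τ′ = (r′, s′, t′)`, `H_τ = H_{τ′}`.  Suppose that `τ` is not a permutation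
of `τ′`, and that g.c.d.`(r, s, t, r′, s′, t′) = 1`.  Then for some `u ∈ (ℤ/Nℤ)*`, `uτ = (⟨ur⟩, ⟨us⟩, ⟨ut⟩)` and `uτ′` are permutations of
`(1, N₁ − 2, 2N₁ + 1)` and `(3, N₁ − 2, 2N₁ − 1)`" — at `n = 3`: `(1, 7, 19)` and `(3, 7, 17)`; Theorem 3 (p. 1186).

WHAT IS PROVED.

* §1 (any level `N`, any pair of multisets `A, B`): if the dichotomy "`{τ′} = {τ}`, or `{uτ, uτ′} = {A, B}` for a unit `u`" holds for every
  pair whose first triple is `(1, s, −1−s)`, it holds for every pair of triples of non-zero residues (sums `0`) with a unit among the six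
  entries (`perm_or_exists_unit_of_normalised`: scale by the inverse of the unit entry, permute, swap the triples).
* §2 `N = 27`: the normalised enumeration `perm_or_exists_unit_twentySeven_normalised` and **the §4 PROPOSITION IN FULL at `N = 27`**
  (`perm_or_exists_unit_of_fermatCMType_eq_twentySeven`): for triples `τ, τ′` of non-zero residues modulo `27` with sums `0`, g.c.d.
  `(r,s,t,r′,s′,t′,27) = 1` (a unit among the six) and `H_{τ′} = H_τ`, either `τ′` is a permutation of `τ`, or for some unit `u`, `uτ` and
  `uτ′` are permutations of `(1, 7, 19)` and `(3, 7, 17)` (in one of the two orders).  In particular the `m = 1` pair `(3,3,21)`, `(9,3,15)` of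
  Theorem 3 (sibling `fermatCMType_twentySeven_eq₁`) is the only kind of coincidence with all six entries divisible by `3` not covered — as
  in the printed statement (g.c.d. `= 1`).

## Honest column / NOT here

* General `n` NOT typed; `N = 81` stays at the listed pairs (sibling).  "Isogeny of lattices" = equality of residue sets, as in the siblings.
  "g.c.d. `= 1`" typed as "a unit among the six entries" (equivalent at prime-power level).  Kernel `decide` only (`maxRecDepth 100000`,
  `maxHeartbeats 4000000`, enlarged instance-synthesis limits).  Private: `map_mul_triple''`, `isUnit_iff_val_coprime₁₂`, the two partial glue
  lemmas.

## References

* [KoblitzRohrlich1978] N. Koblitz, D. Rohrlich, Canad. J. Math. 30 (1978) 1183–1205: §4 Proposition (p. 1198), Theorem 3 (p. 1186), §1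
  (pp. 1184–1185).

## Provenance

Cell `pub-hodgecm2` (COR-CM), literature seat `lit-deligne-3` gen 35 (claim KR78-THM3-27; count-neutral, own lane).
-/

open NumberField

namespace Literature.AlgebraicGeometry.ComplexMultiplication

open Literature.AlgebraicGeometry.HodgeTheory

namespace CyclotomicFermatCMType

/-! ## §1 Any level: the normalisation glue for the dichotomy "permutation, or the exceptional pair up to a common unit" -/

section Glue

variable {N : ℕ} [NeZero N]

/-- The image of a triple under multiplication by `c` (private copy). [folklore] -/
private theorem map_mul_triple'' {α : Type*} [Mul α] (c x y z : α) :
    (({x, y, z} : Multiset α).map (fun w => c * w)) = {c * x, c * y, c * z} := by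
  simp only [Multiset.insert_eq_cons, Multiset.map_cons, Multiset.map_singleton]

/-- Units of `ℤ/N` are the residues with value prime to `N` (private copy of the siblings'). [folklore] -/
private theorem isUnit_iff_val_coprime₁₂ (x : ZMod N) : IsUnit x ↔ x.val.Coprime N := by
  conv_lhs => rw [← ZMod.natCast_zmod_val x]
  exact ZMod.isUnit_iff_coprime x.val N

/-- The glue when the FIRST entry of `τ` is a unit ("multiply through by a suitable `u ∈ (ℤ/Nℤ)*`").
[cite: KoblitzRohrlich1978, §4 (p. 1198) and §1 (p. 1184)] -/
private theorem perm_or_exists_unit_of_isUnit_fst {A B : Multiset (ZMod N)}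
    (S : ∀ s r' s' : ZMod N, s ≠ 0 → (-1 - s : ZMod N) ≠ 0 → r' ≠ 0 → s' ≠ 0 → (-r' - s' : ZMod N) ≠ 0 →
      fermatCMType N r' s' (-r' - s') = fermatCMType N 1 s (-1 - s) →
      ({r', s', -r' - s'} : Multiset (ZMod N)) = {1, s, -1 - s} ∨
        ∃ u : ZMod N, u.val.Coprime N ∧
          ((({u * 1, u * s, u * (-1 - s)} : Multiset (ZMod N)) = A ∧ ({u * r', u * s', u * (-r' - s')} : Multiset (ZMod N)) = B) ∨
            (({u * 1, u * s, u * (-1 - s)} : Multiset (ZMod N)) = B ∧ ({u * r', u * s', u * (-r' - s')} : Multiset (ZMod N)) = A)))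
    {r s t r' s' t' : ZMod N} (hr : IsUnit r) (hs : s ≠ 0) (ht : t ≠ 0) (hrst : r + s + t = 0)
    (hr' : r' ≠ 0) (hs' : s' ≠ 0) (ht' : t' ≠ 0) (hrst' : r' + s' + t' = 0)
    (heq : fermatCMType N r' s' t' = fermatCMType N r s t) :
    ({r', s', t'} : Multiset (ZMod N)) = {r, s, t} ∨
      ∃ u : ZMod N, IsUnit u ∧
        ((({u * r, u * s, u * t} : Multiset (ZMod N)) = A ∧ ({u * r', u * s', u * t'} : Multiset (ZMod N)) = B) ∨
          (({u * r, u * s, u * t} : Multiset (ZMod N)) = B ∧ ({u * r', u * s', u * t'} : Multiset (ZMod N)) = A)) := by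
  obtain rfl : t = -r - s := by linear_combination hrst
  obtain rfl : t' = -r' - s' := by linear_combination hrst'
  obtain ⟨ri, hri⟩ := hr.exists_right_inv
  have hri' : IsUnit ri := IsUnit.of_mul_eq_one_right r hri
  have hri1 : ri * r = 1 := by rw [mul_comm]; exact hri
  have hnz : ∀ {x : ZMod N}, x ≠ 0 → ri * x ≠ 0 := by
    intro x hx h
    apply hx
    have := congrArg (fun y => r * y) h
    simpa only [← mul_assoc, hri, one_mul, mul_zero] using this
  have e₁ : ri * (-r - s) = -1 - ri * s := by linear_combination (-1 : ZMod N) * hri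
  have e₂ : ri * (-r' - s') = -(ri * r') - ri * s' := by ring
  have key : fermatCMType N (ri * r') (ri * s') (ri * (-r' - s')) = fermatCMType N (ri * r) (ri * s) (ri * (-r - s)) := by
    ext x
    rw [mem_fermatCMType_mul_iff_of_isUnit hri', mem_fermatCMType_mul_iff_of_isUnit hri', heq]
  rw [hri1, e₁, e₂] at key
  have c₂ : (-1 - ri * s : ZMod N) ≠ 0 := by rw [← e₁]; exact hnz ht
  have c₅ : (-(ri * r') - ri * s' : ZMod N) ≠ 0 := by rw [← e₂]; exact hnz ht'
  -- the rescaling identities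
  have f₁ : ∀ u : ZMod N, u * ri * r = u * 1 := fun u => by rw [mul_assoc, hri1]
  have f₂ : ∀ u : ZMod N, u * ri * s = u * (ri * s) := fun u => mul_assoc _ _ _
  have f₃ : ∀ u : ZMod N, u * ri * (-r - s) = u * (-1 - ri * s) := fun u => by rw [mul_assoc, e₁]
  have f₄ : ∀ u : ZMod N, u * ri * r' = u * (ri * r') := fun u => mul_assoc _ _ _
  have f₅ : ∀ u : ZMod N, u * ri * s' = u * (ri * s') := fun u => mul_assoc _ _ _
  have f₆ : ∀ u : ZMod N, u * ri * (-r' - s') = u * (-(ri * r') - ri * s') := fun u => by rw [mul_assoc, e₂]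
  rcases S (ri * s) (ri * r') (ri * s') (hnz hs) c₂ (hnz hr') (hnz hs') c₅ key with hu | ⟨u, hu, hAB⟩
  · left
    have hu' := congrArg (Multiset.map (fun w => r * w)) hu
    rwa [map_mul_triple'', map_mul_triple'', show r * (ri * r') = r' by linear_combination r' * hri,
      show r * (ri * s') = s' by linear_combination s' * hri,
      show r * (-(ri * r') - ri * s') = -r' - s' by linear_combination (-r' - s') * hri, mul_one,
      show r * (ri * s) = s by linear_combination s * hri,
      show r * (-1 - ri * s) = -r - s by linear_combination (-s) * hri] at hu'
  · right
    refine ⟨u * ri, ((isUnit_iff_val_coprime₁₂ u).2 hu).mul hri', ?_⟩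
    rw [f₁, f₂, f₃, f₄, f₅, f₆]
    exact hAB

/-- The glue when SOME entry of `τ` is a unit: permute it to the front (`H` depends on the multiset only).
[cite: KoblitzRohrlich1978, §4 (p. 1198) and §1 (p. 1184)] -/
private theorem perm_or_exists_unit_of_isUnit {A B : Multiset (ZMod N)}
    (S : ∀ s r' s' : ZMod N, s ≠ 0 → (-1 - s : ZMod N) ≠ 0 → r' ≠ 0 → s' ≠ 0 → (-r' - s' : ZMod N) ≠ 0 →
      fermatCMType N r' s' (-r' - s') = fermatCMType N 1 s (-1 - s) →
      ({r', s', -r' - s'} : Multiset (ZMod N)) = {1, s, -1 - s} ∨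
        ∃ u : ZMod N, u.val.Coprime N ∧
          ((({u * 1, u * s, u * (-1 - s)} : Multiset (ZMod N)) = A ∧ ({u * r', u * s', u * (-r' - s')} : Multiset (ZMod N)) = B) ∨
            (({u * 1, u * s, u * (-1 - s)} : Multiset (ZMod N)) = B ∧ ({u * r', u * s', u * (-r' - s')} : Multiset (ZMod N)) = A)))
    {r s t r' s' t' : ZMod N} (hr : r ≠ 0) (hs : s ≠ 0) (ht : t ≠ 0) (hrst : r + s + t = 0)
    (hr' : r' ≠ 0) (hs' : s' ≠ 0) (ht' : t' ≠ 0) (hrst' : r' + s' + t' = 0) (hunit : IsUnit r ∨ IsUnit s ∨ IsUnit t)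
    (heq : fermatCMType N r' s' t' = fermatCMType N r s t) :
    ({r', s', t'} : Multiset (ZMod N)) = {r, s, t} ∨
      ∃ u : ZMod N, IsUnit u ∧
        ((({u * r, u * s, u * t} : Multiset (ZMod N)) = A ∧ ({u * r', u * s', u * t'} : Multiset (ZMod N)) = B) ∨
          (({u * r, u * s, u * t} : Multiset (ZMod N)) = B ∧ ({u * r', u * s', u * t'} : Multiset (ZMod N)) = A)) := by
  have p12 : ∀ a b c : ZMod N, ({a, b, c} : Multiset (ZMod N)) = {b, a, c} := fun a b c => by
    rw [Multiset.insert_eq_cons, Multiset.insert_eq_cons, Multiset.insert_eq_cons, Multiset.insert_eq_cons, Multiset.cons_swap]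
  have p23 : ∀ a b c : ZMod N, ({a, b, c} : Multiset (ZMod N)) = {a, c, b} := fun a b c => by
    rw [Multiset.pair_comm b c]
  have p13 : ∀ a b c : ZMod N, ({a, b, c} : Multiset (ZMod N)) = {c, b, a} := fun a b c => by
    rw [p23 a b c, p12 a c b, p23 c a b]
  rcases hunit with hu | hu | hu
  · exact perm_or_exists_unit_of_isUnit_fst S hu hs ht hrst hr' hs' ht' hrst' heq
  · have heq' : fermatCMType N r' s' t' = fermatCMType N s r t := by rw [heq]; exact fermatCMType_eq_of_multiset_eq (p12 r s t)
    rcases perm_or_exists_unit_of_isUnit_fst S hu hr ht (by linear_combination hrst) hr' hs' ht' hrst' heq' with h | ⟨u, hu', hAB⟩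
    · exact Or.inl (h.trans (p12 s r t))
    · refine Or.inr ⟨u, hu', ?_⟩
      rcases hAB with ⟨hA, hB⟩ | ⟨hB, hA⟩
      · exact Or.inl ⟨(p12 _ _ _).trans hA, hB⟩
      · exact Or.inr ⟨(p12 _ _ _).trans hB, hA⟩
  · have heq' : fermatCMType N r' s' t' = fermatCMType N t s r := by rw [heq]; exact fermatCMType_eq_of_multiset_eq (p13 r s t)
    rcases perm_or_exists_unit_of_isUnit_fst S hu hs hr (by linear_combination hrst) hr' hs' ht' hrst' heq' with h | ⟨u, hu', hAB⟩
    · exact Or.inl (h.trans (p13 t s r))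
    · refine Or.inr ⟨u, hu', ?_⟩
      rcases hAB with ⟨hA, hB⟩ | ⟨hB, hA⟩
      · exact Or.inl ⟨(p13 _ _ _).trans hA, hB⟩
      · exact Or.inr ⟨(p13 _ _ _).trans hB, hA⟩

/-- **The normalisation glue** (any level `N`, any exceptional pair `A, B`): if for every pair with first triple `(1, s, −1−s)` a coincidence
`H_{τ′} = H_τ` forces "`{τ′} = {τ}`, or `{uτ, uτ′} = {A, B}` for a unit `u`", then the same holds for every pair of triples of non-zero
residues (sums `0`) with a unit among the six entries ("multiply through by a suitable `u ∈ (ℤ/Nℤ)*`"; permute; swap `τ, τ′`).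
[cite: KoblitzRohrlich1978, §4 Proposition and proof (p. 1198), §1 (p. 1184)] -/
theorem perm_or_exists_unit_of_normalised {A B : Multiset (ZMod N)}
    (S : ∀ s r' s' : ZMod N, s ≠ 0 → (-1 - s : ZMod N) ≠ 0 → r' ≠ 0 → s' ≠ 0 → (-r' - s' : ZMod N) ≠ 0 →
      fermatCMType N r' s' (-r' - s') = fermatCMType N 1 s (-1 - s) →
      ({r', s', -r' - s'} : Multiset (ZMod N)) = {1, s, -1 - s} ∨
        ∃ u : ZMod N, u.val.Coprime N ∧
          ((({u * 1, u * s, u * (-1 - s)} : Multiset (ZMod N)) = A ∧ ({u * r', u * s', u * (-r' - s')} : Multiset (ZMod N)) = B) ∨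
            (({u * 1, u * s, u * (-1 - s)} : Multiset (ZMod N)) = B ∧ ({u * r', u * s', u * (-r' - s')} : Multiset (ZMod N)) = A)))
    {r s t r' s' t' : ZMod N} (hr : r ≠ 0) (hs : s ≠ 0) (ht : t ≠ 0) (hrst : r + s + t = 0)
    (hr' : r' ≠ 0) (hs' : s' ≠ 0) (ht' : t' ≠ 0) (hrst' : r' + s' + t' = 0)
    (hunit : IsUnit r ∨ IsUnit s ∨ IsUnit t ∨ IsUnit r' ∨ IsUnit s' ∨ IsUnit t')
    (heq : fermatCMType N r' s' t' = fermatCMType N r s t) :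
    ({r', s', t'} : Multiset (ZMod N)) = {r, s, t} ∨
      ∃ u : ZMod N, IsUnit u ∧
        ((({u * r, u * s, u * t} : Multiset (ZMod N)) = A ∧ ({u * r', u * s', u * t'} : Multiset (ZMod N)) = B) ∨
          (({u * r, u * s, u * t} : Multiset (ZMod N)) = B ∧ ({u * r', u * s', u * t'} : Multiset (ZMod N)) = A)) := by
  rcases hunit with hu | hu | hu | hu | hu | hu
  · exact perm_or_exists_unit_of_isUnit S hr hs ht hrst hr' hs' ht' hrst' (Or.inl hu) heq
  · exact perm_or_exists_unit_of_isUnit S hr hs ht hrst hr' hs' ht' hrst' (Or.inr (Or.inl hu)) heq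
  · exact perm_or_exists_unit_of_isUnit S hr hs ht hrst hr' hs' ht' hrst' (Or.inr (Or.inr hu)) heq
  · rcases perm_or_exists_unit_of_isUnit S hr' hs' ht' hrst' hr hs ht hrst (Or.inl hu) heq.symm with h | ⟨u, hu', hAB⟩
    · exact Or.inl h.symm
    · exact Or.inr ⟨u, hu', hAB.symm.imp (fun h => ⟨h.2, h.1⟩) (fun h => ⟨h.2, h.1⟩)⟩
  · rcases perm_or_exists_unit_of_isUnit S hr' hs' ht' hrst' hr hs ht hrst (Or.inr (Or.inl hu)) heq.symm with h | ⟨u, hu', hAB⟩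
    · exact Or.inl h.symm
    · exact Or.inr ⟨u, hu', hAB.symm.imp (fun h => ⟨h.2, h.1⟩) (fun h => ⟨h.2, h.1⟩)⟩
  · rcases perm_or_exists_unit_of_isUnit S hr' hs' ht' hrst' hr hs ht hrst (Or.inr (Or.inr hu)) heq.symm with h | ⟨u, hu', hAB⟩
    · exact Or.inl h.symm
    · exact Or.inr ⟨u, hu', hAB.symm.imp (fun h => ⟨h.2, h.1⟩) (fun h => ⟨h.2, h.1⟩)⟩

end Glue

/-! ## §2 `N = 27`: the §4 Proposition in full -/

section TwentySeven

set_option maxRecDepth 100000 in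
set_option maxHeartbeats 4000000 in
set_option synthInstance.maxHeartbeats 400000 in
set_option synthInstance.maxSize 100000 in
/-- **Enumeration at `N = 27`, normalised form** (kernel computation over `27³` cases): for `s, −1−s, r′, s′, −r′−s′` non-zero modulo `27`,
`H_{(r′,s′,−r′−s′)} = H_{(1,s,−1−s)}` forces `{r′,s′,−r′−s′} = {1,s,−1−s}`, or, for some unit `u`, `u·(1,s,−1−s)` and `u·(r′,s′,−r′−s′)` are
permutations of `(1,7,19)` and `(3,7,17)` in one of the two orders. [cite: KoblitzRohrlich1978, §4 Proposition (p. 1198)] -/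
theorem perm_or_exists_unit_twentySeven_normalised :
    ∀ s r' s' : ZMod 27, s ≠ 0 → (-1 - s : ZMod 27) ≠ 0 → r' ≠ 0 → s' ≠ 0 → (-r' - s' : ZMod 27) ≠ 0 →
      fermatCMType 27 r' s' (-r' - s') = fermatCMType 27 1 s (-1 - s) →
      ({r', s', -r' - s'} : Multiset (ZMod 27)) = {1, s, -1 - s} ∨
        ∃ u : ZMod 27, u.val.Coprime 27 ∧
          ((({u * 1, u * s, u * (-1 - s)} : Multiset (ZMod 27)) = {1, 7, 19} ∧
              ({u * r', u * s', u * (-r' - s')} : Multiset (ZMod 27)) = {3, 7, 17}) ∨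
            (({u * 1, u * s, u * (-1 - s)} : Multiset (ZMod 27)) = {3, 7, 17} ∧
              ({u * r', u * s', u * (-r' - s')} : Multiset (ZMod 27)) = {1, 7, 19})) := by
  decide

/-- **THE §4 PROPOSITION (THEOREM 3) IN FULL AT `N = 27`**: for triples `τ = (r,s,t)`, `τ′ = (r′,s′,t′)` of non-zero residues modulo `27`
with `r + s + t = r′ + s′ + t′ = 0`, g.c.d.`(r,s,t,r′,s′,t′,27) = 1` (a unit among the six entries) and `H_{τ′} = H_τ`: either `τ′` is a
permutation of `τ`, or for some unit `u`, `uτ` and `uτ′` are permutations of `(1, N₁ − 2, 2N₁ + 1) = (1, 7, 19)` and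
`(3, N₁ − 2, 2N₁ − 1) = (3, 7, 17)` (in one of the two orders) — "the only isogenies apart from the obvious ones" at `N = 27`.
[cite: KoblitzRohrlich1978, §4 Proposition (p. 1198) and Theorem 3 (p. 1186)] -/
theorem perm_or_exists_unit_of_fermatCMType_eq_twentySeven {r s t r' s' t' : ZMod 27} (hr : r ≠ 0) (hs : s ≠ 0) (ht : t ≠ 0)
    (hrst : r + s + t = 0) (hr' : r' ≠ 0) (hs' : s' ≠ 0) (ht' : t' ≠ 0) (hrst' : r' + s' + t' = 0)
    (hunit : IsUnit r ∨ IsUnit s ∨ IsUnit t ∨ IsUnit r' ∨ IsUnit s' ∨ IsUnit t')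
    (heq : fermatCMType 27 r' s' t' = fermatCMType 27 r s t) :
    ({r', s', t'} : Multiset (ZMod 27)) = {r, s, t} ∨
      ∃ u : ZMod 27, IsUnit u ∧
        ((({u * r, u * s, u * t} : Multiset (ZMod 27)) = {1, 7, 19} ∧ ({u * r', u * s', u * t'} : Multiset (ZMod 27)) = {3, 7, 17}) ∨
          (({u * r, u * s, u * t} : Multiset (ZMod 27)) = {3, 7, 17} ∧ ({u * r', u * s', u * t'} : Multiset (ZMod 27)) = {1, 7, 19})) :=
  perm_or_exists_unit_of_normalised perm_or_exists_unit_twentySeven_normalised hr hs ht hrst hr' hs' ht' hrst' hunit heq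

end TwentySeven

end CyclotomicFermatCMType

end Literature.AlgebraicGeometry.ComplexMultiplication
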